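import Summits.BirchSwinnertonDyer.BirchSwinnertonDyer.Theorems.SignedLowerHalvesKobayashiMainConjectureSmallImageCMTransferMuRecords10
import Summits.BirchSwinnertonDyer.BirchSwinnertonDyer.Theorems.SignedLowerHalvesSmallImageLowerHalfBothSignsRttFloorCert
import Literature.NumberTheory.EllipticCurves.ZywinaCMImageProofs
import Summits.BirchSwinnertonDyer.Rank1Residual.GaloisImage.TorsionIsoImageObstruction
import HarnessLib

/-!
# Route `SignedLowerHalves`, crux L `SmallImageLowerHalfBothSigns` (item stmt-BirchSwinnertonDyer-23599), line `rtt_w3` v4/v5: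
# tier-T1 FLOOR-CERTIFICATE RECORDS, part 02 — crux L's body at the `p = 5` pairs 421596v1, 416448ba1, 416448bd1, 416448by1 FROM PRINT + ONE displayed Mazur–Tate row
# (the existential one-sign floor `hfloor` of `…RttTierOneRecords16–21` REPLACED by a finite certificate)

Width seat `bsd-line-slh-p3-w3` g14 under LEAD `cruxlead-stmt-BirchSwinnertonDyer-23599` g3 (cell `bsd-ssimc`); `--supports
stmt-BirchSwinnertonDyer-23599 --as helper`; THEOREMS ONLY; PER PAIR; closes nothing class-wide; BSD is proved for no curve (every
published input is a named-fact HYPOTHESIS).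

Each record re-proves the LEAD's tier-T1 record `forall_kobayashiLowerDivisibility_c<label>_5_of_print_of_oneSignFloor` (files
`…RttTierOneRecords16–21`, p749742 … p749857: `∀ ε, KobayashiLowerDivisibility W 5 ε` from the TWELVE published named facts of the cite
stub + Fisher Thm 13.2 / 5.8 (`hF`/`hF'`) + the displayed EXISTENTIAL floor `hfloor : ∀ f, IsNewformOf W f → ∃ ε₀ L₀,
IsSignedPAdicLFunction f 5 ε₀ L₀ ∧ HasUnitContent L₀`) with `hfloor` REPLACED by ONE displayed FINITE datum `hrow`: at the ODD layer
`n = 3` (`deg ω_3^+ = deg Φ_25(1+T) = 20`) the Mazur–Tate element `θ_3(f)` of (every) newform `f` of `W` is `5`-integral (`= Θ ∈ Λ`),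
`Θ ≠ 0`, `μ(Θ) = 0`, `λ(Θ) = 20 + l` — by `forall_kobayashiLowerDivisibility_of_cmCurvePartner_of_mazurTateRowOdd` (file `…RttFloorCert`,
this seat: the b2b lane's IMAGE-FREE certificate theorem `lam_signed_neg_one_eq_of_mazurTate'` turns the row into `(μ, λ)(L^−_5(W)) = (0, l)`,
hence unit content of `L^−_5`, hence the floor at `ε₀ = −1`). SOURCE OF THE ROWS (displayed, not kernel): the crux's standing disprover's
kit j335262 (`cdisprove-stmt-BirchSwinnertonDyer-23599`, PREREG `gvkan2` 839c353487edc3e8; `gvkan2/LAYERS.tsv` sha16 09c04126f37ca31c,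
`OUT_B.jsonl`, MANIFEST f84277f2e5294121; evidence #53–#56 on the item), engine B = exact modular symbols `msengine (lit-g7)` + `iwlayer`
(relations checked, `symbols_ok`), ONE engine at `p = 5` (the kit's second engine E ran at `p = 3` only — a second-engine confirmation of
these 14 rows is the natural referee ask); normalisation: the engine's period is Cremona's `Ω` (its `[0]`-value reproduces `allbsd`'s
`L(E,1)/Ω` exactly), which is `plusPeriod f` up to a `5`-adic unit by the period-unit fact `h5` (a hypothesis of every record anyway), so
`μ(θ_3)`, `λ(θ_3)` are normalisation-independent modulo `h5`. The same table gives `μ = 0` at the top EVEN layer too (both signs), and the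
lower rows displayed per pair. Everything else (models, CM partner, Hesse certificate, `¬ Surj` transport) is VERBATIM the LEAD's record.

References: [Kobayashi2003] Conjecture (p. 2), Thm. 7.4; [Pollack2003] Prop. 6.9, 6.10, 6.18, Conj. 6.3; [Fisher2012Hessian] Thm. 13.2,
Thm. 5.8; [Cremona2006] Table 1; [Zywina2015] Prop. 1.14; [SilvermanAEC2009] VII.5 Prop. 5.1; [BDKim2009] Cor. 2.13; [PollackRubin2004]
Theorem (p. 448); [Vatsal1999] (1.6), (1.13).
-/

set_option autoImplicit false
-- D-0017: single-problem summit, the namespace repeats the problem name by design.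
set_option linter.dupNamespace false
noncomputable section

open scoped Classical MatrixGroups ModularForm

open CongruenceSubgroup WeierstrassCurve Literature.NumberTheory.EllipticCurves
  Literature.NumberTheory.EllipticCurves.ModularForms
  Literature.NumberTheory.EllipticCurves.Kobayashi2003 ZpExtension
  Literature.NumberTheory.EllipticCurves.GreenbergVatsal2000
  Literature.NumberTheory.EllipticCurves.Rank1Residual
  Literature.NumberTheory.EllipticCurves.Rank1Residual.Typed
  Literature.NumberTheory.EllipticCurves.Rank1Residual.X11RankOneCertificates
  Literature.NumberTheory.EllipticCurves.Fisher2012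
  Summit.BirchSwinnertonDyer.BirchSwinnertonDyer.Rank1Residual.IntModel
  Summit.BirchSwinnertonDyer.BirchSwinnertonDyer.Rank1Residual.X11RankOne
  Summit.BirchSwinnertonDyer.Rank1Residual.X11b
  Summit.BirchSwinnertonDyer.Rank1Residual.X9
  Summit.BirchSwinnertonDyer.Rank1Residual.X1
  Summit.BirchSwinnertonDyer.Rank1Residual.X1.MuLambda
  Summit.BirchSwinnertonDyer.Rank1Residual.Supersingular

namespace Summit.BirchSwinnertonDyer.BirchSwinnertonDyer.Theorems.SmallImageRttOneSided

/-- **Crux L's body at `421596v1 @ 5` FROM PRINT + ONE MAZUR–TATE ROW** (Cremona model `[0, 0, 0, -9937095, 12056970254]`, `N = 421596 = 2²·3²·7²·239`, X7, `a_5 = 0`, mod-5 image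
`5Nn`): `∀ ε, KobayashiLowerDivisibility W 5 ε` from the cite stub's twelve PUBLISHED named facts + Fisher 2012/2013 (`n = 5` Hesse pencil,
`hF'` by name) + ONE displayed row `hrow` REPLACING the LEAD's existential floor `hfloor` (record `…_c421596v1_5_of_print_of_oneSignFloor`):
at the odd layer `n = 3`, `θ_3(f) = Θ ∈ Λ`, `Θ ≠ 0`, `μ(Θ) = 0`, `λ(Θ) = deg ω_3^+ + 2 = 20 + 2` (kit j335262 `gvkan2/LAYERS.tsv`, engine B,
row `421596v1@5, n=4 (Pollack index 3), odd`: `μ = 0, λ = 22`; lower rows: index 1 (odd) `μ = 0, λ = 2`, index 2 (even, `deg ω_2^- = 4`)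
`μ = 0, λ = 6`) ⇒ `(μ, λ)(L^−_5(W)) = (0, 2)`, floor at `ε₀ = −1`. CM partner `[0,0,0,0,-28] : y² = x³ − 28`, Hesse `5`-congruence `(λ:μ) = (12:1)`,
`u = 433421549568` (X⁻_{E'}(5); k3-c4 record `MuRecords10`, certificate verbatim). Kernel-decided: `5 ∤ Δ`, `#Ẽ(𝔽₅) = 6` (both), additive at `2` (X7),
`j(W) ∉ cmJInvariants`, CM of the partner; `¬ Surj W 5` by Zywina transported along the congruence. Per pair; CONDITIONAL; nothing booked.
[cite: Kobayashi2003, Conjecture (p. 2), Thm. 7.4 (p. 13)] [cite: Pollack2003, Prop. 6.18, Conj. 6.3]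
[cite: Fisher2012Hessian, Thm. 13.2 and Thm. 5.8 (n = 5)] [cite: Cremona2006, Table 1 (Cremona label 421596v1)] [cite: Zywina2015, Prop. 1.14 and Prop. 1.16 (§1.9)] -/
theorem forall_kobayashiLowerDivisibility_c421596v1_5_of_print_of_mazurTateRow
    (hJ : thm62_63_73_signedColemanKato_zetaJoint) (h12 : thm12_signedSelmerDual_finite_torsion)
    (h41 : thm41_signedCharIdeal_divisibility)
    (h5 : realPeriodRat_eq_unit_mul_plusPeriod) (h3 : realPeriodRat_eq_unit_mul_plusPeriod_three)
    (hD : Hida2000_thm326_exists_galoisRep) (hC : Carayol1986_artinConductorExponent)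
    (hS : ∀ (V : WeierstrassCurve ℚ) (ℓ : ℕ) [Fact ℓ.Prime],
      V.swanConductorAt_rationalTate_eq_wildConductorExponent_of_ringChar_eq_two ℓ)
    (hmod : exists_isNewformOf)
    (hKim : BDKim2009.cor213_signedLambda_add_sum_delta_eq_of_torsionIso)
    (hPR : PollackRubin2004.mainTheorem_signedCharIdeal_eq_of_cm) (hV : vatsal1999_plusSymbol_congruence)
    (hF' : thm58_fiveCongruent_hessePencilInd)
    (W A : WeierstrassCurve ℚ) [W.IsElliptic] [W.IsGloballyMinimal] [A.IsElliptic] [A.IsGloballyMinimal]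
    [Fact (Nat.Prime 5)] (hW : W = ⟨0, 0, 0, -9937095, 12056970254⟩) (hA : A = ⟨0, 0, 0, 0, -28⟩)
    (hrow : ∀ [NeZero (W.conductorNorm ℤ)] (f : CuspForm (Gamma0 (W.conductorNorm ℤ)) 2), IsNewformOf W f →
      ∃ Θ : IwasawaAlgebra 5, iwasawaToPowerSeries 5 Θ =
          ((mazurTateElement f 5 3).map (algebraMap ℚ ℚ_[5]) : PowerSeries ℚ_[5]) ∧
        Θ ≠ 0 ∧ mu Θ = 0 ∧ lam Θ = (cyclotomicOmegaPlus 5 3).natDegree + 2) :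
    ∀ ε : ℤˣ, KobayashiLowerDivisibility W 5 ε := by
  have hIW : integralModelInt W = ⟨0, 0, 0, -9937095, 12056970254⟩ :=
    integralModelInt_eq_of_map_eq _ (by rw [hW]; ext <;> simp [WeierstrassCurve.map])
  have hIA : integralModelInt A = ⟨0, 0, 0, 0, -28⟩ :=
    integralModelInt_eq_of_map_eq _ (by rw [hA]; ext <;> simp [WeierstrassCurve.map])
  have hΔ : (⟨0, 0, 0, -9937095, 12056970254⟩ : WeierstrassCurve ℤ).Δ = discOf [0, 0, 0, -9937095, 12056970254] :=
    intCurve_Δ 0 0 0 (-9937095) 12056970254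
  have hΔA : (⟨0, 0, 0, 0, -28⟩ : WeierstrassCurve ℤ).Δ = discOf [0, 0, 0, 0, -28] :=
    intCurve_Δ 0 0 0 0 (-28)
  have hgood : W.HasGoodReductionAtPrime 5 :=
    hasGoodReductionAtPrime_of_not_dvd W 5 (by rw [minimalDiscriminantInt_eq hIW, hΔ]; decide +kernel)
  have hgoodA : A.HasGoodReductionAtPrime 5 :=
    hasGoodReductionAtPrime_of_not_dvd A 5 (by rw [minimalDiscriminantInt_eq hIA, hΔA]; decide +kernel)
  have hap : W.frobeniusTrace 5 = 0 := by rw [frobeniusTrace_eq hIW card_c421596v1_5]; norm_num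
  have hapA : A.frobeniusTrace 5 = 0 := by rw [frobeniusTrace_eq hIA card_cm0m28_5]; norm_num
  have hc4 : W.c₄ = (476980560 : ℚ) := by
    subst hW; norm_num [WeierstrassCurve.c₄, WeierstrassCurve.b₂, WeierstrassCurve.b₄]
  have hc6 : W.c₆ = (-10417222299456 : ℚ) := by
    subst hW; norm_num [WeierstrassCurve.c₆, WeierstrassCurve.b₂, WeierstrassCurve.b₄, WeierstrassCurve.b₆]
  have hc4A : A.c₄ = (0 : ℚ) := by
    subst hA; norm_num [WeierstrassCurve.c₄, WeierstrassCurve.b₂, WeierstrassCurve.b₄]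
  have hc6A : A.c₆ = (24192 : ℚ) := by
    subst hA; norm_num [WeierstrassCurve.c₆, WeierstrassCurve.b₂, WeierstrassCurve.b₄, WeierstrassCurve.b₆]
  have hiso := fiveCongruent_of_hesseIndCertificate hF' A W (12 : ℚ) 1 (433421549568 : ℚ)
    (by norm_num) (by rw [hc4A, hc6A, hc4, eval_hesseC4ind]; norm_num)
    (by rw [hc4A, hc6A, hc6, eval_hesseC6ind]; norm_num)
  -- X7: additive at `2`; `W` non-CM; `¬ Surj W 5` from the CM partner
  have hc₄Z : (⟨0, 0, 0, -9937095, 12056970254⟩ : WeierstrassCurve ℤ).c₄ = c4Of [0, 0, 0, -9937095, 12056970254] :=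
    intCurve_c₄ 0 0 0 (-9937095) 12056970254
  have hX : ClassX7 W 5 :=
    ⟨⟨hgood, by rw [hap]; exact dvd_zero _⟩, not_semistable_of_intModel hIW 2 (by norm_num) (by rw [hΔ]; decide +kernel)
      (by rw [hc₄Z]; decide +kernel)⟩
  have hcm : ¬ W.HasCM := fun h ↦ by
    have hj := (hasCM_iff_j_mem_holds W).mp h
    rw [j_eq_of_intModel 0 0 0 (-9937095) 12056970254 hIW] at hj
    exact absurd hj (by decide +kernel)
  have hcmA : A.HasCM := hasCM_cm0m28 hIA
  have hs : ¬ Surj W 5 := by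
    obtain ⟨e, he⟩ := hiso
    intro hsW
    exact WeierstrassCurve.not_hasSurjectiveModNGaloisRep_of_hasCM A hcmA (by norm_num : Nat.Prime 5) (by norm_num)
      (Summit.BirchSwinnertonDyer.Rank1Residual.GaloisImage.hasSurjectiveModNGaloisRep_of_torsionIso e he hsW)
  exact forall_kobayashiLowerDivisibility_of_cmCurvePartner_of_mazurTateRowOdd W A 5 hJ h12 h41 h5 h3 hD hC hS hmod hKim hPR hV
    (by norm_num) hX hcm hap hs hcmA ⟨hgoodA, by rw [hapA]; exact dvd_zero _⟩ hapA hiso (by decide : Odd 3) hrow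

/-- **Crux L's body at `416448ba1 @ 5` FROM PRINT + ONE MAZUR–TATE ROW** (Cremona model `[0, 0, 0, -184440, -30964394]`, `N = 416448 = 2⁶·3³·241`, X7, `a_5 = 0`, mod-5 image
`5Nn`): `∀ ε, KobayashiLowerDivisibility W 5 ε` from the cite stub's twelve PUBLISHED named facts + Fisher 2012/2013 (`n = 5` Hesse pencil,
`hF'` by name) + ONE displayed row `hrow` REPLACING the LEAD's existential floor `hfloor` (record `…_c416448ba1_5_of_print_of_oneSignFloor`):
at the odd layer `n = 3`, `θ_3(f) = Θ ∈ Λ`, `Θ ≠ 0`, `μ(Θ) = 0`, `λ(Θ) = deg ω_3^+ + 2 = 20 + 2` (kit j335262 `gvkan2/LAYERS.tsv`, engine B,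
row `416448ba1@5, n=4 (Pollack index 3), odd`: `μ = 0, λ = 22`; lower rows: index 1 (odd) `μ = 0, λ = 2`, index 2 (even, `deg ω_2^- = 4`)
`μ = 0, λ = 6`) ⇒ `(μ, λ)(L^−_5(W)) = (0, 2)`, floor at `ε₀ = −1`. CM partner `[0,0,0,0,-2] : y² = x³ − 2`, Hesse `5`-congruence `(λ:μ) = (24:1)`,
`u = 10319560704` (X⁻_{E'}(5); k3-c4 record `MuRecords10`, certificate verbatim). Kernel-decided: `5 ∤ Δ`, `#Ẽ(𝔽₅) = 6` (both), additive at `2` (X7),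
`j(W) ∉ cmJInvariants`, CM of the partner; `¬ Surj W 5` by Zywina transported along the congruence. Per pair; CONDITIONAL; nothing booked.
[cite: Kobayashi2003, Conjecture (p. 2), Thm. 7.4 (p. 13)] [cite: Pollack2003, Prop. 6.18, Conj. 6.3]
[cite: Fisher2012Hessian, Thm. 13.2 and Thm. 5.8 (n = 5)] [cite: Cremona2006, Table 1 (Cremona label 416448ba1)] [cite: Zywina2015, Prop. 1.14 and Prop. 1.16 (§1.9)] -/
theorem forall_kobayashiLowerDivisibility_c416448ba1_5_of_print_of_mazurTateRow
    (hJ : thm62_63_73_signedColemanKato_zetaJoint) (h12 : thm12_signedSelmerDual_finite_torsion)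
    (h41 : thm41_signedCharIdeal_divisibility)
    (h5 : realPeriodRat_eq_unit_mul_plusPeriod) (h3 : realPeriodRat_eq_unit_mul_plusPeriod_three)
    (hD : Hida2000_thm326_exists_galoisRep) (hC : Carayol1986_artinConductorExponent)
    (hS : ∀ (V : WeierstrassCurve ℚ) (ℓ : ℕ) [Fact ℓ.Prime],
      V.swanConductorAt_rationalTate_eq_wildConductorExponent_of_ringChar_eq_two ℓ)
    (hmod : exists_isNewformOf)
    (hKim : BDKim2009.cor213_signedLambda_add_sum_delta_eq_of_torsionIso)
    (hPR : PollackRubin2004.mainTheorem_signedCharIdeal_eq_of_cm) (hV : vatsal1999_plusSymbol_congruence)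
    (hF' : thm58_fiveCongruent_hessePencilInd)
    (W A : WeierstrassCurve ℚ) [W.IsElliptic] [W.IsGloballyMinimal] [A.IsElliptic] [A.IsGloballyMinimal]
    [Fact (Nat.Prime 5)] (hW : W = ⟨0, 0, 0, -184440, -30964394⟩) (hA : A = ⟨0, 0, 0, 0, -2⟩)
    (hrow : ∀ [NeZero (W.conductorNorm ℤ)] (f : CuspForm (Gamma0 (W.conductorNorm ℤ)) 2), IsNewformOf W f →
      ∃ Θ : IwasawaAlgebra 5, iwasawaToPowerSeries 5 Θ =
          ((mazurTateElement f 5 3).map (algebraMap ℚ ℚ_[5]) : PowerSeries ℚ_[5]) ∧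
        Θ ≠ 0 ∧ mu Θ = 0 ∧ lam Θ = (cyclotomicOmegaPlus 5 3).natDegree + 2) :
    ∀ ε : ℤˣ, KobayashiLowerDivisibility W 5 ε := by
  have hIW : integralModelInt W = ⟨0, 0, 0, -184440, -30964394⟩ :=
    integralModelInt_eq_of_map_eq _ (by rw [hW]; ext <;> simp [WeierstrassCurve.map])
  have hIA : integralModelInt A = ⟨0, 0, 0, 0, -2⟩ :=
    integralModelInt_eq_of_map_eq _ (by rw [hA]; ext <;> simp [WeierstrassCurve.map])
  have hΔ : (⟨0, 0, 0, -184440, -30964394⟩ : WeierstrassCurve ℤ).Δ = discOf [0, 0, 0, -184440, -30964394] :=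
    intCurve_Δ 0 0 0 (-184440) (-30964394)
  have hΔA : (⟨0, 0, 0, 0, -2⟩ : WeierstrassCurve ℤ).Δ = discOf [0, 0, 0, 0, -2] :=
    intCurve_Δ 0 0 0 0 (-2)
  have hgood : W.HasGoodReductionAtPrime 5 :=
    hasGoodReductionAtPrime_of_not_dvd W 5 (by rw [minimalDiscriminantInt_eq hIW, hΔ]; decide +kernel)
  have hgoodA : A.HasGoodReductionAtPrime 5 :=
    hasGoodReductionAtPrime_of_not_dvd A 5 (by rw [minimalDiscriminantInt_eq hIA, hΔA]; decide +kernel)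
  have hap : W.frobeniusTrace 5 = 0 := by rw [frobeniusTrace_eq hIW card_c416448ba1_5]; norm_num
  have hapA : A.frobeniusTrace 5 = 0 := by rw [frobeniusTrace_eq hIA card_cm0m2_5]; norm_num
  have hc4 : W.c₄ = (8853120 : ℚ) := by
    subst hW; norm_num [WeierstrassCurve.c₄, WeierstrassCurve.b₂, WeierstrassCurve.b₄]
  have hc6 : W.c₆ = (26753236416 : ℚ) := by
    subst hW; norm_num [WeierstrassCurve.c₆, WeierstrassCurve.b₂, WeierstrassCurve.b₄, WeierstrassCurve.b₆]
  have hc4A : A.c₄ = (0 : ℚ) := by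
    subst hA; norm_num [WeierstrassCurve.c₄, WeierstrassCurve.b₂, WeierstrassCurve.b₄]
  have hc6A : A.c₆ = (1728 : ℚ) := by
    subst hA; norm_num [WeierstrassCurve.c₆, WeierstrassCurve.b₂, WeierstrassCurve.b₄, WeierstrassCurve.b₆]
  have hiso := fiveCongruent_of_hesseIndCertificate hF' A W (24 : ℚ) 1 (10319560704 : ℚ)
    (by norm_num) (by rw [hc4A, hc6A, hc4, eval_hesseC4ind]; norm_num)
    (by rw [hc4A, hc6A, hc6, eval_hesseC6ind]; norm_num)
  -- X7: additive at `2`; `W` non-CM; `¬ Surj W 5` from the CM partner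
  have hc₄Z : (⟨0, 0, 0, -184440, -30964394⟩ : WeierstrassCurve ℤ).c₄ = c4Of [0, 0, 0, -184440, -30964394] :=
    intCurve_c₄ 0 0 0 (-184440) (-30964394)
  have hX : ClassX7 W 5 :=
    ⟨⟨hgood, by rw [hap]; exact dvd_zero _⟩, not_semistable_of_intModel hIW 2 (by norm_num) (by rw [hΔ]; decide +kernel)
      (by rw [hc₄Z]; decide +kernel)⟩
  have hcm : ¬ W.HasCM := fun h ↦ by
    have hj := (hasCM_iff_j_mem_holds W).mp h
    rw [j_eq_of_intModel 0 0 0 (-184440) (-30964394) hIW] at hj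
    exact absurd hj (by decide +kernel)
  have hcmA : A.HasCM := hasCM_cm0m2 hIA
  have hs : ¬ Surj W 5 := by
    obtain ⟨e, he⟩ := hiso
    intro hsW
    exact WeierstrassCurve.not_hasSurjectiveModNGaloisRep_of_hasCM A hcmA (by norm_num : Nat.Prime 5) (by norm_num)
      (Summit.BirchSwinnertonDyer.Rank1Residual.GaloisImage.hasSurjectiveModNGaloisRep_of_torsionIso e he hsW)
  exact forall_kobayashiLowerDivisibility_of_cmCurvePartner_of_mazurTateRowOdd W A 5 hJ h12 h41 h5 h3 hD hC hS hmod hKim hPR hV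
    (by norm_num) hX hcm hap hs hcmA ⟨hgoodA, by rw [hapA]; exact dvd_zero _⟩ hapA hiso (by decide : Odd 3) hrow

/-- **Crux L's body at `416448bd1 @ 5` FROM PRINT + ONE MAZUR–TATE ROW** (Cremona model `[0, 0, 0, -1659960, 836038638]`, `N = 416448 = 2⁶·3³·241`, X7, `a_5 = 0`, mod-5 image
`5Nn`): `∀ ε, KobayashiLowerDivisibility W 5 ε` from the cite stub's twelve PUBLISHED named facts + Fisher 2012/2013 (`n = 5` Hesse pencil,
`hF` by name) + ONE displayed row `hrow` REPLACING the LEAD's existential floor `hfloor` (record `…_c416448bd1_5_of_print_of_oneSignFloor`):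
at the odd layer `n = 3`, `θ_3(f) = Θ ∈ Λ`, `Θ ≠ 0`, `μ(Θ) = 0`, `λ(Θ) = deg ω_3^+ + 2 = 20 + 2` (kit j335262 `gvkan2/LAYERS.tsv`, engine B,
row `416448bd1@5, n=4 (Pollack index 3), odd`: `μ = 0, λ = 22`; lower rows: index 1 (odd) `μ = 0, λ = 2`, index 2 (even, `deg ω_2^- = 4`)
`μ = 0, λ = 6`) ⇒ `(μ, λ)(L^−_5(W)) = (0, 2)`, floor at `ε₀ = −1`. CM partner `[0,0,0,0,-2] : y² = x³ − 2`, Hesse `5`-congruence `(λ:μ) = (-48:1)`,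
`u = 23887872` (X_{E'}(5); k3-c4 record `MuRecords10`, certificate verbatim). Kernel-decided: `5 ∤ Δ`, `#Ẽ(𝔽₅) = 6` (both), additive at `2` (X7),
`j(W) ∉ cmJInvariants`, CM of the partner; `¬ Surj W 5` by Zywina transported along the congruence. Per pair; CONDITIONAL; nothing booked.
[cite: Kobayashi2003, Conjecture (p. 2), Thm. 7.4 (p. 13)] [cite: Pollack2003, Prop. 6.18, Conj. 6.3]
[cite: Fisher2012Hessian, Thm. 13.2 and Thm. 5.8 (n = 5)] [cite: Cremona2006, Table 1 (Cremona label 416448bd1)] [cite: Zywina2015, Prop. 1.14 and Prop. 1.16 (§1.9)] -/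
theorem forall_kobayashiLowerDivisibility_c416448bd1_5_of_print_of_mazurTateRow
    (hJ : thm62_63_73_signedColemanKato_zetaJoint) (h12 : thm12_signedSelmerDual_finite_torsion)
    (h41 : thm41_signedCharIdeal_divisibility)
    (h5 : realPeriodRat_eq_unit_mul_plusPeriod) (h3 : realPeriodRat_eq_unit_mul_plusPeriod_three)
    (hD : Hida2000_thm326_exists_galoisRep) (hC : Carayol1986_artinConductorExponent)
    (hS : ∀ (V : WeierstrassCurve ℚ) (ℓ : ℕ) [Fact ℓ.Prime],
      V.swanConductorAt_rationalTate_eq_wildConductorExponent_of_ringChar_eq_two ℓ)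
    (hmod : exists_isNewformOf)
    (hKim : BDKim2009.cor213_signedLambda_add_sum_delta_eq_of_torsionIso)
    (hPR : PollackRubin2004.mainTheorem_signedCharIdeal_eq_of_cm) (hV : vatsal1999_plusSymbol_congruence)
    (hF : thm132_fiveCongruent_hessePencil)
    (W A : WeierstrassCurve ℚ) [W.IsElliptic] [W.IsGloballyMinimal] [A.IsElliptic] [A.IsGloballyMinimal]
    [Fact (Nat.Prime 5)] (hW : W = ⟨0, 0, 0, -1659960, 836038638⟩) (hA : A = ⟨0, 0, 0, 0, -2⟩)
    (hrow : ∀ [NeZero (W.conductorNorm ℤ)] (f : CuspForm (Gamma0 (W.conductorNorm ℤ)) 2), IsNewformOf W f →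
      ∃ Θ : IwasawaAlgebra 5, iwasawaToPowerSeries 5 Θ =
          ((mazurTateElement f 5 3).map (algebraMap ℚ ℚ_[5]) : PowerSeries ℚ_[5]) ∧
        Θ ≠ 0 ∧ mu Θ = 0 ∧ lam Θ = (cyclotomicOmegaPlus 5 3).natDegree + 2) :
    ∀ ε : ℤˣ, KobayashiLowerDivisibility W 5 ε := by
  have hIW : integralModelInt W = ⟨0, 0, 0, -1659960, 836038638⟩ :=
    integralModelInt_eq_of_map_eq _ (by rw [hW]; ext <;> simp [WeierstrassCurve.map])
  have hIA : integralModelInt A = ⟨0, 0, 0, 0, -2⟩ :=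
    integralModelInt_eq_of_map_eq _ (by rw [hA]; ext <;> simp [WeierstrassCurve.map])
  have hΔ : (⟨0, 0, 0, -1659960, 836038638⟩ : WeierstrassCurve ℤ).Δ = discOf [0, 0, 0, -1659960, 836038638] :=
    intCurve_Δ 0 0 0 (-1659960) 836038638
  have hΔA : (⟨0, 0, 0, 0, -2⟩ : WeierstrassCurve ℤ).Δ = discOf [0, 0, 0, 0, -2] :=
    intCurve_Δ 0 0 0 0 (-2)
  have hgood : W.HasGoodReductionAtPrime 5 :=
    hasGoodReductionAtPrime_of_not_dvd W 5 (by rw [minimalDiscriminantInt_eq hIW, hΔ]; decide +kernel)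
  have hgoodA : A.HasGoodReductionAtPrime 5 :=
    hasGoodReductionAtPrime_of_not_dvd A 5 (by rw [minimalDiscriminantInt_eq hIA, hΔA]; decide +kernel)
  have hap : W.frobeniusTrace 5 = 0 := by rw [frobeniusTrace_eq hIW card_c416448bd1_5]; norm_num
  have hapA : A.frobeniusTrace 5 = 0 := by rw [frobeniusTrace_eq hIA card_cm0m2_5]; norm_num
  have hc4 : W.c₄ = (79678080 : ℚ) := by
    subst hW; norm_num [WeierstrassCurve.c₄, WeierstrassCurve.b₂, WeierstrassCurve.b₄]
  have hc6 : W.c₆ = (-722337383232 : ℚ) := by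
    subst hW; norm_num [WeierstrassCurve.c₆, WeierstrassCurve.b₂, WeierstrassCurve.b₄, WeierstrassCurve.b₆]
  have hc4A : A.c₄ = (0 : ℚ) := by
    subst hA; norm_num [WeierstrassCurve.c₄, WeierstrassCurve.b₂, WeierstrassCurve.b₄]
  have hc6A : A.c₆ = (1728 : ℚ) := by
    subst hA; norm_num [WeierstrassCurve.c₆, WeierstrassCurve.b₂, WeierstrassCurve.b₄, WeierstrassCurve.b₆]
  have hiso := fiveCongruent_of_hesseCertificate hF A W (-48 : ℚ) 1 (23887872 : ℚ)
    (by norm_num) (by rw [hc4A, hc6A, hc4, eval_hesseC4]; norm_num)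
    (by rw [hc4A, hc6A, hc6, eval_hesseC6]; norm_num)
  -- X7: additive at `2`; `W` non-CM; `¬ Surj W 5` from the CM partner
  have hc₄Z : (⟨0, 0, 0, -1659960, 836038638⟩ : WeierstrassCurve ℤ).c₄ = c4Of [0, 0, 0, -1659960, 836038638] :=
    intCurve_c₄ 0 0 0 (-1659960) 836038638
  have hX : ClassX7 W 5 :=
    ⟨⟨hgood, by rw [hap]; exact dvd_zero _⟩, not_semistable_of_intModel hIW 2 (by norm_num) (by rw [hΔ]; decide +kernel)
      (by rw [hc₄Z]; decide +kernel)⟩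
  have hcm : ¬ W.HasCM := fun h ↦ by
    have hj := (hasCM_iff_j_mem_holds W).mp h
    rw [j_eq_of_intModel 0 0 0 (-1659960) 836038638 hIW] at hj
    exact absurd hj (by decide +kernel)
  have hcmA : A.HasCM := hasCM_cm0m2 hIA
  have hs : ¬ Surj W 5 := by
    obtain ⟨e, he⟩ := hiso
    intro hsW
    exact WeierstrassCurve.not_hasSurjectiveModNGaloisRep_of_hasCM A hcmA (by norm_num : Nat.Prime 5) (by norm_num)
      (Summit.BirchSwinnertonDyer.Rank1Residual.GaloisImage.hasSurjectiveModNGaloisRep_of_torsionIso e he hsW)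
  exact forall_kobayashiLowerDivisibility_of_cmCurvePartner_of_mazurTateRowOdd W A 5 hJ h12 h41 h5 h3 hD hC hS hmod hKim hPR hV
    (by norm_num) hX hcm hap hs hcmA ⟨hgoodA, by rw [hapA]; exact dvd_zero _⟩ hapA hiso (by decide : Odd 3) hrow

/-- **Crux L's body at `416448by1 @ 5` FROM PRINT + ONE MAZUR–TATE ROW** (Cremona model `[0, 0, 0, -1659960, -836038638]`, `N = 416448 = 2⁶·3³·241`, X7, `a_5 = 0`, mod-5 image
`5Nn`): `∀ ε, KobayashiLowerDivisibility W 5 ε` from the cite stub's twelve PUBLISHED named facts + Fisher 2012/2013 (`n = 5` Hesse pencil,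
`hF` by name) + ONE displayed row `hrow` REPLACING the LEAD's existential floor `hfloor` (record `…_c416448by1_5_of_print_of_oneSignFloor`):
at the odd layer `n = 3`, `θ_3(f) = Θ ∈ Λ`, `Θ ≠ 0`, `μ(Θ) = 0`, `λ(Θ) = deg ω_3^+ + 2 = 20 + 2` (kit j335262 `gvkan2/LAYERS.tsv`, engine B,
row `416448by1@5, n=4 (Pollack index 3), odd`: `μ = 0, λ = 22`; lower rows: index 1 (odd) `μ = 0, λ = 2`, index 2 (even, `deg ω_2^- = 4`)
`μ = 0, λ = 6`) ⇒ `(μ, λ)(L^−_5(W)) = (0, 2)`, floor at `ε₀ = −1`. CM partner `[0,0,0,0,2] : y² = x³ + 2`, Hesse `5`-congruence `(λ:μ) = (48:1)`,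
`u = 23887872` (X_{E'}(5); k3-c4 record `MuRecords10`, certificate verbatim). Kernel-decided: `5 ∤ Δ`, `#Ẽ(𝔽₅) = 6` (both), additive at `2` (X7),
`j(W) ∉ cmJInvariants`, CM of the partner; `¬ Surj W 5` by Zywina transported along the congruence. Per pair; CONDITIONAL; nothing booked.
[cite: Kobayashi2003, Conjecture (p. 2), Thm. 7.4 (p. 13)] [cite: Pollack2003, Prop. 6.18, Conj. 6.3]
[cite: Fisher2012Hessian, Thm. 13.2 and Thm. 5.8 (n = 5)] [cite: Cremona2006, Table 1 (Cremona label 416448by1)] [cite: Zywina2015, Prop. 1.14 and Prop. 1.16 (§1.9)] -/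
theorem forall_kobayashiLowerDivisibility_c416448by1_5_of_print_of_mazurTateRow
    (hJ : thm62_63_73_signedColemanKato_zetaJoint) (h12 : thm12_signedSelmerDual_finite_torsion)
    (h41 : thm41_signedCharIdeal_divisibility)
    (h5 : realPeriodRat_eq_unit_mul_plusPeriod) (h3 : realPeriodRat_eq_unit_mul_plusPeriod_three)
    (hD : Hida2000_thm326_exists_galoisRep) (hC : Carayol1986_artinConductorExponent)
    (hS : ∀ (V : WeierstrassCurve ℚ) (ℓ : ℕ) [Fact ℓ.Prime],
      V.swanConductorAt_rationalTate_eq_wildConductorExponent_of_ringChar_eq_two ℓ)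
    (hmod : exists_isNewformOf)
    (hKim : BDKim2009.cor213_signedLambda_add_sum_delta_eq_of_torsionIso)
    (hPR : PollackRubin2004.mainTheorem_signedCharIdeal_eq_of_cm) (hV : vatsal1999_plusSymbol_congruence)
    (hF : thm132_fiveCongruent_hessePencil)
    (W A : WeierstrassCurve ℚ) [W.IsElliptic] [W.IsGloballyMinimal] [A.IsElliptic] [A.IsGloballyMinimal]
    [Fact (Nat.Prime 5)] (hW : W = ⟨0, 0, 0, -1659960, -836038638⟩) (hA : A = ⟨0, 0, 0, 0, 2⟩)
    (hrow : ∀ [NeZero (W.conductorNorm ℤ)] (f : CuspForm (Gamma0 (W.conductorNorm ℤ)) 2), IsNewformOf W f →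
      ∃ Θ : IwasawaAlgebra 5, iwasawaToPowerSeries 5 Θ =
          ((mazurTateElement f 5 3).map (algebraMap ℚ ℚ_[5]) : PowerSeries ℚ_[5]) ∧
        Θ ≠ 0 ∧ mu Θ = 0 ∧ lam Θ = (cyclotomicOmegaPlus 5 3).natDegree + 2) :
    ∀ ε : ℤˣ, KobayashiLowerDivisibility W 5 ε := by
  have hIW : integralModelInt W = ⟨0, 0, 0, -1659960, -836038638⟩ :=
    integralModelInt_eq_of_map_eq _ (by rw [hW]; ext <;> simp [WeierstrassCurve.map])
  have hIA : integralModelInt A = ⟨0, 0, 0, 0, 2⟩ :=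
    integralModelInt_eq_of_map_eq _ (by rw [hA]; ext <;> simp [WeierstrassCurve.map])
  have hΔ : (⟨0, 0, 0, -1659960, -836038638⟩ : WeierstrassCurve ℤ).Δ = discOf [0, 0, 0, -1659960, -836038638] :=
    intCurve_Δ 0 0 0 (-1659960) (-836038638)
  have hΔA : (⟨0, 0, 0, 0, 2⟩ : WeierstrassCurve ℤ).Δ = discOf [0, 0, 0, 0, 2] :=
    intCurve_Δ 0 0 0 0 2
  have hgood : W.HasGoodReductionAtPrime 5 :=
    hasGoodReductionAtPrime_of_not_dvd W 5 (by rw [minimalDiscriminantInt_eq hIW, hΔ]; decide +kernel)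
  have hgoodA : A.HasGoodReductionAtPrime 5 :=
    hasGoodReductionAtPrime_of_not_dvd A 5 (by rw [minimalDiscriminantInt_eq hIA, hΔA]; decide +kernel)
  have hap : W.frobeniusTrace 5 = 0 := by rw [frobeniusTrace_eq hIW card_c416448by1_5]; norm_num
  have hapA : A.frobeniusTrace 5 = 0 := by rw [frobeniusTrace_eq hIA card_cm0p2_5]; norm_num
  have hc4 : W.c₄ = (79678080 : ℚ) := by
    subst hW; norm_num [WeierstrassCurve.c₄, WeierstrassCurve.b₂, WeierstrassCurve.b₄]
  have hc6 : W.c₆ = (722337383232 : ℚ) := by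
    subst hW; norm_num [WeierstrassCurve.c₆, WeierstrassCurve.b₂, WeierstrassCurve.b₄, WeierstrassCurve.b₆]
  have hc4A : A.c₄ = (0 : ℚ) := by
    subst hA; norm_num [WeierstrassCurve.c₄, WeierstrassCurve.b₂, WeierstrassCurve.b₄]
  have hc6A : A.c₆ = (-1728 : ℚ) := by
    subst hA; norm_num [WeierstrassCurve.c₆, WeierstrassCurve.b₂, WeierstrassCurve.b₄, WeierstrassCurve.b₆]
  have hiso := fiveCongruent_of_hesseCertificate hF A W (48 : ℚ) 1 (23887872 : ℚ)
    (by norm_num) (by rw [hc4A, hc6A, hc4, eval_hesseC4]; norm_num)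
    (by rw [hc4A, hc6A, hc6, eval_hesseC6]; norm_num)
  -- X7: additive at `2`; `W` non-CM; `¬ Surj W 5` from the CM partner
  have hc₄Z : (⟨0, 0, 0, -1659960, -836038638⟩ : WeierstrassCurve ℤ).c₄ = c4Of [0, 0, 0, -1659960, -836038638] :=
    intCurve_c₄ 0 0 0 (-1659960) (-836038638)
  have hX : ClassX7 W 5 :=
    ⟨⟨hgood, by rw [hap]; exact dvd_zero _⟩, not_semistable_of_intModel hIW 2 (by norm_num) (by rw [hΔ]; decide +kernel)
      (by rw [hc₄Z]; decide +kernel)⟩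
  have hcm : ¬ W.HasCM := fun h ↦ by
    have hj := (hasCM_iff_j_mem_holds W).mp h
    rw [j_eq_of_intModel 0 0 0 (-1659960) (-836038638) hIW] at hj
    exact absurd hj (by decide +kernel)
  have hcmA : A.HasCM := hasCM_cm0p2 hIA
  have hs : ¬ Surj W 5 := by
    obtain ⟨e, he⟩ := hiso
    intro hsW
    exact WeierstrassCurve.not_hasSurjectiveModNGaloisRep_of_hasCM A hcmA (by norm_num : Nat.Prime 5) (by norm_num)
      (Summit.BirchSwinnertonDyer.Rank1Residual.GaloisImage.hasSurjectiveModNGaloisRep_of_torsionIso e he hsW)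
  exact forall_kobayashiLowerDivisibility_of_cmCurvePartner_of_mazurTateRowOdd W A 5 hJ h12 h41 h5 h3 hD hC hS hmod hKim hPR hV
    (by norm_num) hX hcm hap hs hcmA ⟨hgoodA, by rw [hapA]; exact dvd_zero _⟩ hapA hiso (by decide : Odd 3) hrow

end Summit.BirchSwinnertonDyer.BirchSwinnertonDyer.Theorems.SmallImageRttOneSided

end
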